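import Literature.NumberTheory.EllipticCurves.LegendreDescentProofs
import HarnessLib

/-!
# The explicit isomorphism onto the Legendre form over `k(E[2], √(e₂ − e₁))` (Silverman *AEC* III.1.7)

`Proofs` file (theorems only; no definitions, no named facts, no instances) in topic
`NumberTheory/EllipticCurves`, companion of `LegendreDescentProofs` ([IUTchIV] Prop. 1.8 (vi), first
sentence, in real form: rational `2`-torsion ⇒ `j(W) = j(Legendre λ)`, `λ ∈ k`) and of
`PotentialGoodReductionLegendreProofs`, whose proof of
`hasGoodReductionAt_baseChange_of_b_eq_of_sq_eq` contains — inline, in a valued-number-field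
setting — the computation isolated here for arbitrary fields of characteristic `0`. Written by the
cell `abc-iut` (seat abc-iut-L5-t12).

**The isomorphism, not just the `j`-invariant.** If the `2`-division cubic `4x³ + b₂x² + 2b₄x + b₆`
of a Weierstrass equation `W` over `L` has roots `e₁, e₂, e₃` (recorded through `b₂ = −4σ₁`,
`b₄ = 2σ₂`, `b₆ = −4σ₃`) and `s ∈ L` is a square root of `e₂ − e₁ ≠ 0`, then the change of
variables `(u, r, s, t) = (s, e₁, −a₁/2, −(a₃ + e₁a₁)/2)` — complete the square, move `e₁` to the
origin, rescale by `u = √(e₂ − e₁)` — carries `W` to the Legendre equation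
`y² = x(x − 1)(x − λ) = ⟨0, −(1 + λ), 0, λ, 0⟩`, `λ = (e₃ − e₁)/(e₂ − e₁)` (Silverman *AEC*
Prop. III.1.7 and its proof: "the substitution `x = (e₂ − e₁)x′ + e₁`, `y = (e₂ − e₁)^{3/2}y′`").
Hence, for `W` over `k` whose `2`-division cubic splits in an extension `L ∋ e₁, e₂, e₃, √(e₂ − e₁)`
(e.g. `L ⊇ k(W[4])`, or `L` algebraically closed), `W/L ≅ Legendre(λ)/L` by an explicit change of
variables over `L` (`exists_variableChange_baseChange_eq_legendre`): this is the sense in which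
"`E_k̄` descends to … the Legendre form" ([IUTchIV] Prop. 1.8 (vi), kurims Apr-2020 p. 19) with the
descent field made explicit — `k(e₁, e₂, e₃, √(e₂ − e₁))`, a subfield of `k(E[4])`, in general NOT
of a `2·3·5`-torsion field (relevant to [IUTchIV] Thm. 1.10 p. 22, "`F = F_mod(√−1, E_{F_mod}[2·3·5])
:= F_tpd(√−1, E_{F_tpd}[3·5])`").

## References

* [SilvermanAEC2009] J. H. Silverman, *The Arithmetic of Elliptic Curves*, 2nd ed., III.1 Table 3.1,
  Prop. III.1.7 and its proof.
* [Mochizuki2012] S. Mochizuki, IUT IV, Prop. 1.8 (vi) p. 19; Thm. 1.10 p. 22.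

## Design

Pure theorems; characteristic `0`. The first theorem is adapted (with credit) from the inline
computation `hVa₁ … hVa₆` of `PotentialGoodReductionLegendreProofs` (seat of bsd.S15). Axioms:
`propext`, `Classical.choice`, `Quot.sound`.
-/

noncomputable section

open scoped Classical

universe u v

namespace WeierstrassCurve

open Literature.NumberTheory.EllipticCurves

section Explicit

variable {L : Type v} [Field L] [CharZero L] (WL : WeierstrassCurve L)

/-- **The change of variables onto the Legendre form** (Silverman *AEC* Prop. III.1.7, proof): if
`a₁² + 4a₂ = −4(e₁ + e₂ + e₃)`, `2a₄ + a₁a₃ = 2(e₁e₂ + e₁e₃ + e₂e₃)`, `a₃² + 4a₆ = −4e₁e₂e₃` (i.e.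
`b₂, b₄, b₆` are those of `4∏(x − eᵢ)`) and `s² = e₂ − e₁`, `s ≠ 0`, then
`(s, e₁, −a₁/2, −(a₃ + e₁a₁)/2) • W = ⟨0, −(1 + λ), 0, λ, 0⟩` with `λ = (e₃ − e₁)/(e₂ − e₁)`
(adapted from the tree's `hasGoodReductionAt_baseChange_of_b_eq_of_sq_eq`).
[cite: SilvermanAEC2009, Prop. III.1.7 (proof)] -/
theorem smul_eq_legendre_of_b_eq_of_sq_eq {e₁ e₂ e₃ s : L}
    (hB₂ : WL.a₁ ^ 2 + 4 * WL.a₂ = -4 * (e₁ + e₂ + e₃))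
    (hB₄ : 2 * WL.a₄ + WL.a₁ * WL.a₃ = 2 * (e₁ * e₂ + e₁ * e₃ + e₂ * e₃))
    (hB₆ : WL.a₃ ^ 2 + 4 * WL.a₆ = -4 * (e₁ * e₂ * e₃)) (hs : s ^ 2 = e₂ - e₁) (hs0 : s ≠ 0) :
    (⟨Units.mk0 s hs0, e₁, -WL.a₁ / 2, -(WL.a₃ + e₁ * WL.a₁) / 2⟩ : VariableChange L) • WL =
      ⟨0, -(1 + (e₃ - e₁) / (e₂ - e₁)), 0, (e₃ - e₁) / (e₂ - e₁), 0⟩ := by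
  have he : e₂ - e₁ ≠ 0 := by rw [← hs]; exact pow_ne_zero 2 hs0
  set C : VariableChange L := ⟨Units.mk0 s hs0, e₁, -WL.a₁ / 2, -(WL.a₃ + e₁ * WL.a₁) / 2⟩ with hC
  set lam : L := (e₃ - e₁) / (e₂ - e₁) with hlam
  have hCu : (↑C.u⁻¹ : L) = s⁻¹ := by rw [Units.val_inv_eq_inv_val, hC, Units.val_mk0]
  have hVa₁ : (C • WL).a₁ = 0 := by
    rw [variableChange_a₁, hCu, hC]
    ring
  have hVa₃ : (C • WL).a₃ = 0 := by
    rw [variableChange_a₃, hCu, hC]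
    ring
  have hVa₂ : (C • WL).a₂ = -(1 + lam) := by
    rw [variableChange_a₂, hCu, hC, hlam]
    simp only
    rw [inv_pow, hs]
    field_simp
    linear_combination hB₂
  have hnum₄ : WL.a₄ - C.s * WL.a₃ + 2 * C.r * WL.a₂ - (C.t + C.r * C.s) * WL.a₁ + 3 * C.r ^ 2
      - 2 * C.s * C.t = (e₂ - e₁) * (e₃ - e₁) := by
    rw [hC]
    linear_combination (1 / 2 : L) * hB₄ + (e₁ / 2) * hB₂
  have hVa₄ : (C • WL).a₄ = lam := by
    rw [variableChange_a₄, hnum₄, hCu, hlam, inv_pow, show s ^ 4 = (s ^ 2) ^ 2 by ring, hs]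
    field_simp
  have hnum₆ : WL.a₆ + C.r * WL.a₄ + C.r ^ 2 * WL.a₂ + C.r ^ 3 - C.t * WL.a₃ - C.t ^ 2
      - C.r * C.t * WL.a₁ = 0 := by
    rw [hC]
    linear_combination (1 / 4 : L) * hB₆ + (e₁ / 2) * hB₄ + (e₁ ^ 2 / 4) * hB₂
  have hVa₆ : (C • WL).a₆ = 0 := by
    rw [variableChange_a₆, hnum₆, mul_zero]
  ext
  · exact hVa₁
  · exact hVa₂
  · exact hVa₃
  · exact hVa₄
  · exact hVa₆

end Explicit

section Descent

variable {k : Type u} {L : Type v} [Field k] [Field L] [CharZero L] [Algebra k L]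
  (W : WeierstrassCurve k) [W.IsElliptic]

/-- **`W/L ≅ Legendre(λ)/L` over any `L ∋ e₁, e₂, e₃, √(e₂ − e₁)`** (Silverman *AEC* Prop. III.1.7;
[IUTchIV] Prop. 1.8 (vi) with the descent field made explicit): if the `2`-division cubic of `W/k`
has roots `e₁, e₂, e₃` in `L` (characteristic `0`) and `s² = e₂ − e₁` for some `s ∈ L`, then
`C • W/L = ⟨0, −(1 + λ), 0, λ, 0⟩`, `λ = (e₃ − e₁)/(e₂ − e₁)`, for an explicit change of variables
`C = (s, e₁, −a₁/2, −(a₃ + e₁a₁)/2)` over `L` (`W` elliptic, so that `e₁ ≠ e₂` and `s ≠ 0`).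
[cite: SilvermanAEC2009, Prop. III.1.7 (proof)] -/
theorem exists_variableChange_baseChange_eq_legendre {e₁ e₂ e₃ s : L}
    (h3 : (Cubic.map (algebraMap k L) W.twoTorsionPolynomial).roots = {e₁, e₂, e₃})
    (hs : s ^ 2 = e₂ - e₁) :
    ∃ C : VariableChange L,
      C • W.baseChange L = ⟨0, -(1 + (e₃ - e₁) / (e₂ - e₁)), 0, (e₃ - e₁) / (e₂ - e₁), 0⟩ := by
  obtain ⟨hb₂, hb₄, hb₆, -, -⟩ := b_c_Δ_eq_of_roots_eq (W := W) h3
  set WL := W.baseChange L with hWL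
  have hB₂ : WL.a₁ ^ 2 + 4 * WL.a₂ = -4 * (e₁ + e₂ + e₃) := by
    rw [← hb₂, ← map_b₂]; rfl
  have hB₄ : 2 * WL.a₄ + WL.a₁ * WL.a₃ = 2 * (e₁ * e₂ + e₁ * e₃ + e₂ * e₃) := by
    rw [← hb₄, ← map_b₄]; rfl
  have hB₆ : WL.a₃ ^ 2 + 4 * WL.a₆ = -4 * (e₁ * e₂ * e₃) := by
    rw [← hb₆, ← map_b₆]; rfl
  have hs0 : s ≠ 0 := by
    intro h0
    obtain ⟨h12, -, -⟩ := WeierstrassCurve.roots_ne_of_roots_eq W h3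
    rw [h0, zero_pow two_ne_zero] at hs
    exact h12 (sub_eq_zero.mp hs.symm).symm
  exact ⟨_, WL.smul_eq_legendre_of_b_eq_of_sq_eq hB₂ hB₄ hB₆ hs hs0⟩

/-- **Over an algebraically closed extension, `W/L ≅ Legendre(λ)/L` for the `λ` of any labelling of
the roots** of the `2`-division cubic (a square root of `e₂ − e₁` exists). Silverman *AEC* III.1.7.
[cite: SilvermanAEC2009, Prop. III.1.7 (proof)] -/
theorem exists_variableChange_baseChange_eq_legendre_of_isAlgClosed [IsAlgClosed L] {e₁ e₂ e₃ : L}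
    (h3 : (Cubic.map (algebraMap k L) W.twoTorsionPolynomial).roots = {e₁, e₂, e₃}) :
    ∃ C : VariableChange L,
      C • W.baseChange L = ⟨0, -(1 + (e₃ - e₁) / (e₂ - e₁)), 0, (e₃ - e₁) / (e₂ - e₁), 0⟩ := by
  obtain ⟨s, hs⟩ := IsAlgClosed.exists_pow_nat_eq (e₂ - e₁) two_pos
  exact W.exists_variableChange_baseChange_eq_legendre h3 hs

end Descent

end WeierstrassCurve
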